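import Literature.Analysis.FluidPDE.OnsagerBDSVOscillationCorrectorProof
import Literature.Analysis.FluidPDE.OnsagerBDSVPrincipalPartBound
import Literature.Analysis.FluidPDE.OnsagerBDSVPotentialTheoryProofs
import Literature.Analysis.FluidPDE.OnsagerBDSVBiotSavart
import Literature.Analysis.FunctionSpaces.TorusEnstrophyOrthogonality
import HarnessLib

/-!
# The BDSV Nash error (§6.1.1): proof of `BDSV.nashErrorEstimate`

Buckmaster–De Lellis–Székelyhidi–Vicol (BDSV), *Onsager's conjecture for admissible weak
solutions*, CPAM 72 (2019) = arXiv:1701.08678, §6.1.1, bound the Nash error of the new Reynolds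
stress, `ℛ(w_{q+1}·∇v̄_q)`, by `δ_{q+1}^{1/2} δ_q^{1/2} λ_q λ_{q+1}^{-(1-α)}` (arXiv (6.5)), expanding
`w_{q+1}` in Mikado Fourier modes and applying the stationary phase estimate Prop. C.2 to each
mode. This file PROVES the named fact `BDSV.nashErrorEstimate` of `OnsagerBDSVStressSplit.lean`
(the transcription with the exponent `λ_{q+1}^{-(1-4α)}` of Prop. 6.1 (6.1)):

  `BDSV.nashErrorEstimate_holds : nashErrorEstimate`.

The proof given here takes the Calderón–Zygmund route available for the tree's curl form of the
perturbation (arXiv (5.28), `BDSV.perturbation = n_{q+1}⁻¹ curl Z`, `Z = BDSV.potential`): since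
`w_{q+1}` is an exact curl,

  `(w_{q+1}·∇) v̄_q = n_{q+1}⁻¹ (curl Z·∇) v̄_q = n_{q+1}⁻¹ div (Z × ∇v̄_q)`,
  `(Z × ∇v̄)` the `2`-tensor with columns `G_a = Σ_{b,c} ε_{abc} Z_b ∂_c v̄_q`

(`BDSV.convect_curl_eq_tensorDivergence`: the second-order terms cancel by the symmetry of mixed
partials), so that `ℛ((w_{q+1}·∇)v̄_q) = n_{q+1}⁻¹ ℛ div G` and the order-zero Calderón–Zygmund
operator `ℛ div` is bounded on `C^α` (BDSV Prop. C.1 — the tree's PROVED `BDSV.holderCZBound_holds`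
and `BDSV.holder_antidivergence_tensorDivergence_le`; this is the mechanism of "`ℛ curl` is a
zero-order operator", BDSV §4.4, and of the bound arXiv (6.9) for `𝒪₂`). The remaining inputs are
the bounds `‖Z‖₀ ≲ δ_{q+1}^{1/2}`, `‖∇Z‖₀ ≲ δ_{q+1}^{1/2} λ_{q+1}` (proved here exactly as Cor. 5.8
(5.29) is proved in `OnsagerBDSVPrincipalPartBound.lean`, `Z` having the structure of `w_o` with
`(∇Φ_i)ᵀ, V` in place of `adj ∇Φ_i, W`: Lemmas 5.3, 5.4, Prop. 5.7 (5.23) through the proved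
`BDSV.gradPhiBound_holds`, Remark 5.2, and arXiv (6.4), (6.6)), the inductive bounds (2.19)
`‖v̄_q‖_{1+N} ≤ C_in δ_q^{1/2} λ_q ℓ^{-N}` (`N = 0, 1`), the interpolation
`[f]_α ≲ ‖f‖₀^{1-α} ‖∇f‖₀^α` (App. A (A.3)), the product rule (A.2), and arXiv (6.4) `ℓλ_{q+1} ≥ 1`:

  `‖ℛ((w_{q+1}·∇)v̄_q)‖_α ≲ λ_{q+1}⁻¹ ‖Z‖_α ‖∇v̄_q‖_α ≲ λ_{q+1}⁻¹ (δ_{q+1}^{1/2} λ_{q+1}^α)(δ_q^{1/2} λ_q ℓ^{-α})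
   ≲ δ_{q+1}^{1/2} δ_q^{1/2} λ_q λ_{q+1}^{-1+2α} ≤ δ_{q+1}^{1/2} δ_q^{1/2} λ_q λ_{q+1}^{-(1-4α)}`.

Contents: the curl identity (`BDSV.crossGradTensor`, `BDSV.convect_curl_eq_tensorDivergence`) and
the Nash term as `n⁻¹ div G` (`BDSV.nashSource_eq_smul_tensorDivergence`); the `C^{0,r}` bound of the
tensor from pointwise data (`Torus.eContDiffHolderNorm_crossGradTensor_le`); the pointwise bounds on
`Z` and `∇Z` under `BDSV.PerturbationHypotheses` (`BDSV.PerturbationData.norm_potential_le`,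
`BDSV.PerturbationData.norm_partialDeriv_potential_le`) and along the common prefix
(`BDSV.potentialBound_stageFact`); and the assembly `BDSV.nashErrorEstimate_holds`.

## References

* T. Buckmaster, C. De Lellis, L. Székelyhidi Jr., V. Vicol, *Onsager's conjecture for admissible
  weak solutions*, Comm. Pure Appl. Math. 72 (2019) 229–274 = arXiv:1701.08678, §6.1.1
  (arXiv (6.2)–(6.5)), Prop. 6.1 (6.1); §5.3 (5.28); §5.5 Prop. 5.7 (5.23), Cor. 5.8 (5.29) and its
  proof; Lemmas 5.3, 5.4; §4.4; App. A (A.2)–(A.3); App. C Prop. C.1. Equation numbers as in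
  arXiv:1701.08678v1 (cf. `OnsagerBDSVStressSplit.lean`, "Numbering").
* D. Gilbarg, N. Trudinger, *Elliptic PDE of second order* (2001), §4.1 (4.7).
-/

open MeasureTheory Set
open scoped NNReal ENNReal ContDiff Matrix Matrix.Norms.Elementwise

noncomputable section

/-! ## The curl identity `(curl Z·∇) v = div (Z × ∇v)` -/

namespace Literature.Analysis.FluidPDE

namespace BDSV

open FunctionSpaces FunctionSpaces.Torus

/-- The flat three-torus `T³ = (ℝ/ℤ)³`, local notation. -/
local notation "𝕋³" => UnitAddTorus (Fin 3)

/-- Euclidean `ℝ³`, local notation. -/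
local notation "ℝ³" => EuclideanSpace ℝ (Fin 3)

/-- Real `3 × 3` matrices, local notation. -/
local notation "𝕄" => Matrix (Fin 3) (Fin 3) ℝ

section CurlIdentity

/-- The `2`-tensor `Z × ∇v` by columns, `G_a = Σ_{b,c} ε_{abc} Z_b ∂_c v`:
`G₀ = Z₁ ∂₂v - Z₂ ∂₁v`, `G₁ = Z₂ ∂₀v - Z₀ ∂₂v`, `G₂ = Z₀ ∂₁v - Z₁ ∂₀v`. [folklore] -/
def crossGradTensor (Z v : 𝕋³ → ℝ³) (x : 𝕋³) : Fin 3 → ℝ³ :=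
  ![Z x 1 • Torus.partialDeriv 2 v x - Z x 2 • Torus.partialDeriv 1 v x,
    Z x 2 • Torus.partialDeriv 0 v x - Z x 0 • Torus.partialDeriv 2 v x,
    Z x 0 • Torus.partialDeriv 1 v x - Z x 1 • Torus.partialDeriv 0 v x]

/-- Column `0` of `Z × ∇v`. [folklore] -/
@[simp] theorem crossGradTensor_zero (Z v : 𝕋³ → ℝ³) (x : 𝕋³) :
    crossGradTensor Z v x 0 = Z x 1 • Torus.partialDeriv 2 v x - Z x 2 • Torus.partialDeriv 1 v x := rfl

/-- Column `1` of `Z × ∇v`. [folklore] -/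
@[simp] theorem crossGradTensor_one (Z v : 𝕋³ → ℝ³) (x : 𝕋³) :
    crossGradTensor Z v x 1 = Z x 2 • Torus.partialDeriv 0 v x - Z x 0 • Torus.partialDeriv 2 v x := rfl

/-- Column `2` of `Z × ∇v`. [folklore] -/
@[simp] theorem crossGradTensor_two (Z v : 𝕋³ → ℝ³) (x : 𝕋³) :
    crossGradTensor Z v x 2 = Z x 0 • Torus.partialDeriv 1 v x - Z x 1 • Torus.partialDeriv 0 v x := rfl

/-- The generic column of `Z × ∇v`: for every `a` there are `b, c` with
`G_a = Z_b ∂_c v - Z_c ∂_b v`. [folklore] -/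
theorem crossGradTensor_column (Z v : 𝕋³ → ℝ³) (a : Fin 3) : ∃ b c : Fin 3,
    (fun x => crossGradTensor Z v x a) = fun x => Z x b • Torus.partialDeriv c v x - Z x c • Torus.partialDeriv b v x := by
  fin_cases a
  · exact ⟨1, 2, rfl⟩
  · exact ⟨2, 0, rfl⟩
  · exact ⟨0, 1, rfl⟩

/-- One column of the computation: `∂_a (Z_b ∂_c v - Z_c ∂_b v)` by the Leibniz rule. [folklore] -/
theorem partialDeriv_crossColumn {Z v : 𝕋³ → ℝ³} (hZ : IsSmooth Z) (hv : IsSmooth v)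
    (a b c : Fin 3) (x : 𝕋³) :
    Torus.partialDeriv a (fun y => Z y b • Torus.partialDeriv c v y - Z y c • Torus.partialDeriv b v y) x =
      (Z x b • Torus.partialDeriv a (Torus.partialDeriv c v) x + Torus.partialDeriv a Z x b • Torus.partialDeriv c v x) -
        (Z x c • Torus.partialDeriv a (Torus.partialDeriv b v) x + Torus.partialDeriv a Z x c • Torus.partialDeriv b v x) := by
  have hZ1 : IsContDiff 1 Z := hZ.isContDiff (by simp)
  have hZc : ∀ j, IsContDiff 1 (fun y => Z y j) := fun j => (hZ.apply j).isContDiff (by simp)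
  have hdv : ∀ j, IsContDiff 1 (Torus.partialDeriv j v) := fun j => (hv.partialDeriv j).isContDiff (by simp)
  have hprod : ∀ b c : Fin 3, IsContDiff 1 (fun y => Z y b • Torus.partialDeriv c v y) :=
    fun b c => ContDiff.smul (hZc b) (hdv c)
  rw [Torus.partialDeriv_sub_at (hprod b c) (hprod c b),
    partialDeriv_smul (hZc b) (hdv c), partialDeriv_smul (hZc c) (hdv b),
    partialDeriv_apply_coord hZ1, partialDeriv_apply_coord hZ1]

/-- **`(curl Z·∇) v = div (Z × ∇v)`** for smooth `Z`, `v` on `T³`: expanding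
`div (Z × ∇v) = Σ_a ∂_a Σ_{b,c} ε_{abc} Z_b ∂_c v`, the terms `ε_{abc} Z_b ∂_a∂_c v` cancel by the
symmetry of mixed partials and the terms `ε_{abc} (∂_a Z_b) ∂_c v` sum to `Σ_c (curl Z)_c ∂_c v`
(the vector-calculus identity `div (A × B) = B·curl A - A·curl B` with `curl ∇ = 0`). [folklore] -/
theorem convect_curl_eq_tensorDivergence {Z v : 𝕋³ → ℝ³} (hZ : IsSmooth Z) (hv : IsSmooth v)
    (x : 𝕋³) :
    Torus.convect (curl Z) v x = Torus.tensorDivergence (crossGradTensor Z v) x := by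
  have hv1 : IsContDiff 1 v := hv.isContDiff (by simp)
  rw [convect_eq_sum_smul_partialDeriv hv1, Fin.sum_univ_three, curl_apply_zero, curl_apply_one,
    curl_apply_two, Torus.tensorDivergence, Fin.sum_univ_three]
  have e0 : (fun y => crossGradTensor Z v y 0) =
      fun y => Z y 1 • Torus.partialDeriv 2 v y - Z y 2 • Torus.partialDeriv 1 v y := rfl
  have e1 : (fun y => crossGradTensor Z v y 1) =
      fun y => Z y 2 • Torus.partialDeriv 0 v y - Z y 0 • Torus.partialDeriv 2 v y := rfl
  have e2 : (fun y => crossGradTensor Z v y 2) =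
      fun y => Z y 0 • Torus.partialDeriv 1 v y - Z y 1 • Torus.partialDeriv 0 v y := rfl
  rw [e0, e1, e2, partialDeriv_crossColumn hZ hv 0 1 2 x, partialDeriv_crossColumn hZ hv 1 2 0 x,
    partialDeriv_crossColumn hZ hv 2 0 1 x,
    partialDeriv_comm hv 1 0 x, partialDeriv_comm hv 2 0 x, partialDeriv_comm hv 2 1 x]
  module

/-- The tensor `Z × ∇v` is smooth for smooth `Z`, `v`. [folklore] -/
theorem isSmooth_crossGradTensor {Z v : 𝕋³ → ℝ³} (hZ : IsSmooth Z) (hv : IsSmooth v) :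
    IsSmooth (crossGradTensor Z v) := by
  have hcol : ∀ b c : Fin 3, IsSmooth (fun y => Z y b • Torus.partialDeriv c v y - Z y c • Torus.partialDeriv b v y) :=
    fun b c => ((hZ.apply b).smul' (hv.partialDeriv c)).sub ((hZ.apply c).smul' (hv.partialDeriv b))
  refine contDiff_pi.2 fun a => ?_
  obtain ⟨b, c, h⟩ := crossGradTensor_column Z v a
  have h' : (fun y => lift (crossGradTensor Z v) y a) = lift (fun y => crossGradTensor Z v y a) := rfl
  rw [h', h]
  exact hcol b c

/-- The convective derivative is homogeneous in the transporting field: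
`((c u)·∇) v = c (u·∇) v`. [folklore] -/
theorem convect_const_smul_left' {F : Type*} [NormedAddCommGroup F] [NormedSpace ℝ F]
    (c : ℝ) (u : 𝕋³ → ℝ³) (v : 𝕋³ → F) (x : 𝕋³) :
    Torus.convect (fun y => c • u y) v x = c • Torus.convect u v x := by
  simp only [Torus.convect, map_smul]

end CurlIdentity

/-! ## The Nash term as `n⁻¹ div (Z × ∇v̄)` -/

section NashTerm

variable {P : Params} {S : Setting} {η : ℕ → ℝ → 𝕋³ → ℝ} {D : ℕ → ℝ → 𝕋³ → ℝ³}

/-- **The Nash term is `n_{q+1}⁻¹` times a divergence**: with `w_{q+1} = n_{q+1}⁻¹ curl Z`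
(arXiv (5.28)), `(w_{q+1}·∇) v̄_q = n_{q+1}⁻¹ div (Z × ∇v̄_q)` on every smooth time slice.
[cite: BuckmasterEtAl2018, §5.3 (5.28) and §4.4 ("ℛ curl is a zero-order operator")] -/
theorem nashSource_eq_smul_tensorDivergence (𝔚 : MikadoDatum mikadoRadius) {t : ℝ}
    (hZ : IsSmooth (potential P S 𝔚 η D t)) (hv : IsSmooth (S.vbar t)) (x : 𝕋³) :
    nashSource P S 𝔚 η D t x =
      ((P.freqNat (S.q + 1) : ℝ))⁻¹ •
        Torus.tensorDivergence (crossGradTensor (potential P S 𝔚 η D t) (S.vbar t)) x := by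
  have e : perturbation P S 𝔚 η D t = fun y => ((P.freqNat (S.q + 1) : ℝ))⁻¹ • curl (potential P S 𝔚 η D t) y :=
    rfl
  rw [nashSource, e, convect_const_smul_left', convect_curl_eq_tensorDivergence hZ hv]

end NashTerm

end BDSV

end Literature.Analysis.FluidPDE

/-! ## The `C^{0,r}` norm of `Z × ∇v` from pointwise data -/

namespace Literature.Analysis.FunctionSpaces.Torus

open Literature.Analysis.FluidPDE.BDSV

variable {Y : Type*} [NormedAddCommGroup Y] [NormedSpace ℝ Y]

/-- `‖f - g‖_{∞} + [f - g]_r ≤ (‖f‖_∞ + [f]_r) + (‖g‖_∞ + [g]_r)`. [folklore] -/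
theorem eBoundedHolderNorm_sub_le {X : Type*} [MetricSpace X] (r : ℝ≥0) (f g : X → Y) :
    eBoundedHolderNorm r (f - g) ≤ eBoundedHolderNorm r f + eBoundedHolderNorm r g := by
  rw [sub_eq_add_neg]
  refine (eBoundedHolderNorm_add_le f (-g)).trans (le_of_eq ?_)
  simp only [eBoundedHolderNorm, eSupNorm_neg, eHolderNorm_neg_eq]

/-- **The tensor `Z × ∇v` in `C^{0,r}` from pointwise data** (the product rule (A.2)/(4.7) applied to
the six products `Z_b ∂_c v`): for smooth `Z, v` on `T³` with `‖Z‖ ≤ z₀`, `[Z]_r ≤ Hz`,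
`‖∂_c v‖ ≤ g₀`, `[∂_c v]_r ≤ Hg` (`c = 0, 1, 2`), the lifted `C^{0,r}` norm of `Z × ∇v` is at most
`3 · 2 · (z₀ (g₀ + Hg) + Hz g₀)`. [folklore] -/
theorem eContDiffHolderNorm_crossGradTensor_le {Z v : UnitAddTorus (Fin 3) → EuclideanSpace ℝ (Fin 3)}
    (hZ : IsSmooth Z) (hv : IsSmooth v) (r : ℝ≥0) {z₀ g₀ Hz Hg : ℝ≥0}
    (hz0 : ∀ x, ‖Z x‖ ≤ z₀) (hg0 : ∀ c x, ‖partialDeriv c v x‖ ≤ g₀)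
    (hHz : eHolderNorm r Z ≤ Hz) (hHg : ∀ c, eHolderNorm r (partialDeriv c v) ≤ Hg) :
    Torus.eContDiffHolderNorm 0 r (crossGradTensor Z v) ≤
      (3 : ℝ≥0∞) * ((2 * (z₀ * (g₀ + Hg) + Hz * g₀) : ℝ≥0) : ℝ≥0∞) := by
  -- components of `Z`
  have hz0j : ∀ j x, ‖Z x j‖ ≤ z₀ := fun j x => (PiLp.norm_apply_le (Z x) j).trans (hz0 x)
  have hHzj : ∀ j, eHolderNorm r (fun x => Z x j) ≤ Hz := fun j => (eHolderNorm_apply_le r Z j).trans hHz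
  -- one product
  have hprod : ∀ b c, eBoundedHolderNorm r (fun y => Z y b • partialDeriv c v y) ≤ z₀ * (g₀ + Hg) + Hz * g₀ :=
    fun b c => eBoundedHolderNorm_smul_le_of_bounds ENNReal.coe_ne_top ENNReal.coe_ne_top (hz0j b) (hg0 c)
      (hHzj b) (hHg c)
  -- one column
  have hcol : ∀ a, Torus.eContDiffHolderNorm 0 r (fun y => crossGradTensor Z v y a) ≤
      ((2 * (z₀ * (g₀ + Hg) + Hz * g₀) : ℝ≥0) : ℝ≥0∞) := by
    intro a
    obtain ⟨b, c, h⟩ := crossGradTensor_column Z v a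
    rw [h]
    have hfun : (fun x => Z x b • partialDeriv c v x - Z x c • partialDeriv b v x) =
        (fun y => Z y b • partialDeriv c v y) - fun y => Z y c • partialDeriv b v y := rfl
    refine (eContDiffHolderNorm_zero_le_eBoundedHolderNorm r _).trans ?_
    rw [hfun]
    refine (eBoundedHolderNorm_sub_le r _ _).trans ?_
    push_cast
    rw [two_mul]
    exact add_le_add (hprod b c) (hprod c b)
  -- the tensor
  have hcs : ∀ a, IsContDiff ((0 : ℕ) : WithTop ℕ∞) (fun y => crossGradTensor Z v y a) := fun a =>
    ((contDiff_pi.1 (isSmooth_crossGradTensor hZ hv)) a).of_le (by simp)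
  refine (eContDiffHolderNorm_zero_pi_le r _ hcs).trans ?_
  calc ∑ a, Torus.eContDiffHolderNorm 0 r (fun y => crossGradTensor Z v y a)
      ≤ ∑ _a : Fin 3, ((2 * (z₀ * (g₀ + Hg) + Hz * g₀) : ℝ≥0) : ℝ≥0∞) := Finset.sum_le_sum fun a _ => hcol a
    _ = _ := by rw [Finset.sum_const, Finset.card_univ, Fintype.card_fin, nsmul_eq_mul]; norm_cast

end Literature.Analysis.FunctionSpaces.Torus

/-! ## Pointwise bounds on the potential `Z` and its first derivatives -/

namespace Literature.Analysis.FluidPDE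

namespace BDSV

open FunctionSpaces FunctionSpaces.Torus

/-- The flat three-torus `T³ = (ℝ/ℤ)³`, local notation. -/
local notation "𝕋³" => UnitAddTorus (Fin 3)

/-- Euclidean `ℝ³`, local notation. -/
local notation "ℝ³" => EuclideanSpace ℝ (Fin 3)

/-- Real `3 × 3` matrices, local notation. -/
local notation "𝕄" => Matrix (Fin 3) (Fin 3) ℝ

section Pointwise

variable {P : Params} {S : Setting} {Nbar : ℕ} {Cin C₀ c₀ : ℝ} {Cη : ℕ → ℕ → ℝ}

/-- **Sup bound on the potential `Z`** (as in the first estimate of the proof of Prop. 6.2, where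
`‖Z‖₀ ≲ δ_{q+1}^{1/2}` is used after one integration by parts): under the standing hypotheses with
`C_in ≥ 0`, `c₀ > 0`, `a ≥ 1` and `4δ_{q+2} ≤ δ_{q+1}λ_q^{-α}`, if the Mikado potential `V` is bounded
by `K_V` on the ball `‖R‖_∞ ≤ 9e^{8C_in}(1 + 8C_in)`, then
`‖Z(t,x)‖ ≤ (9 e^{4C_in} K_V / c₀^{1/2}) δ_{q+1}^{1/2}` on `[0,T] × T³`: at each point at most one
cut-off is active, `|ρ_{q,i}^{1/2}| ≤ (δ_{q+1}/c₀)^{1/2}` (Lemma 5.4), `‖∇Φ_iᵀ‖_∞ ≤ e^{4C_in}` on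
`supp η_i` (Lemma 5.4 (5.14)) and `R̃_{q,i}` stays in the ball (Remark 5.2).
[cite: BuckmasterEtAl2018, Prop. 6.2 (proof, first estimate) with Lemma 5.4] -/
theorem PerturbationData.norm_potential_le (H : PerturbationHypotheses P S Nbar Cin C₀)
    (𝒟 : PerturbationData P S c₀ Cη) (𝔚 : MikadoDatum mikadoRadius) (hc₀ : 0 < c₀) (hCin : 0 ≤ Cin)
    (ha : 1 ≤ P.a) (hb : 1 ≤ P.b) (hβ : 0 ≤ P.β) (hα : 0 ≤ P.α)
    (h4 : 4 * amp P.β P.a P.b (S.q + 2) ≤ amp P.β P.a P.b (S.q + 1) * freq P.a P.b S.q ^ (-P.α))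
    {KV : ℝ} (hKV0 : 0 ≤ KV)
    (hKV : ∀ R ∈ Metric.closedBall (0 : 𝕄) (9 * Real.exp (8 * Cin) * (1 + 8 * Cin)),
      ∀ ξ : 𝕋³, ‖𝔚.V R ξ‖ ≤ KV)
    {t : ℝ} (ht : t ∈ Icc 0 S.T) (x : 𝕋³) :
    ‖potential P S 𝔚 𝒟.cut.η 𝒟.D t x‖ ≤
      9 * Real.exp (4 * Cin) * KV / Real.sqrt c₀ * Real.sqrt (amp P.β P.a P.b (S.q + 1)) := by
  set B : ℝ := 9 * Real.exp (4 * Cin) * KV / Real.sqrt c₀ * Real.sqrt (amp P.β P.a P.b (S.q + 1))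
    with hB
  have hB0 : 0 ≤ B := by positivity
  refine 𝒟.cut.norm_sum_le t x hB0 (fun i hi => by rw [sqrtRhoI, hi, zero_mul, zero_smul]) ?_ _
  intro i
  by_cases hη : 𝒟.cut.η i t x = 0
  · rw [sqrtRhoI, hη, zero_mul, zero_smul, norm_zero]
    exact hB0
  · rw [norm_smul, Real.norm_eq_abs]
    have h1 := 𝒟.abs_sqrtRhoI_le H hc₀ ha ht i x
    have hG : ‖(gradPhi 𝒟.D i t x)ᵀ‖ ≤ Real.exp (4 * Cin) := by
      rw [Matrix.norm_transpose]
      exact 𝒟.norm_gradPhi_le H hCin ha hb hβ hα ht hη x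
    have hRt : tildeR P S 𝒟.cut.η 𝒟.D i t x ∈
        Metric.closedBall (0 : 𝕄) (9 * Real.exp (8 * Cin) * (1 + 8 * Cin)) := by
      rw [Metric.mem_closedBall, dist_zero_right]
      exact 𝒟.norm_tildeR_le H hCin ha hb hβ hα h4 ht hη x
    have hVle := hKV _ hRt (P.freqNat (S.q + 1) • phiPoint 𝒟.D i t x)
    have h2 := norm_toEuclideanLin_le (gradPhi 𝒟.D i t x)ᵀ
      (𝔚.V (tildeR P S 𝒟.cut.η 𝒟.D i t x) (P.freqNat (S.q + 1) • phiPoint 𝒟.D i t x))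
    have h3 : 9 * ‖(gradPhi 𝒟.D i t x)ᵀ‖ *
        ‖𝔚.V (tildeR P S 𝒟.cut.η 𝒟.D i t x) (P.freqNat (S.q + 1) • phiPoint 𝒟.D i t x)‖ ≤
        9 * Real.exp (4 * Cin) * KV :=
      mul_le_mul (mul_le_mul_of_nonneg_left hG (by norm_num)) hVle (norm_nonneg _) (by positivity)
    have hsq : Real.sqrt (amp P.β P.a P.b (S.q + 1) / c₀) =
        Real.sqrt (amp P.β P.a P.b (S.q + 1)) / Real.sqrt c₀ := Real.sqrt_div (amp_pos ha _).le c₀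
    calc |sqrtRhoI P S 𝒟.cut.η i t x| *
          ‖Matrix.toEuclideanLin (gradPhi 𝒟.D i t x)ᵀ
            (𝔚.V (tildeR P S 𝒟.cut.η 𝒟.D i t x) (P.freqNat (S.q + 1) • phiPoint 𝒟.D i t x))‖
        ≤ Real.sqrt (amp P.β P.a P.b (S.q + 1) / c₀) * (9 * Real.exp (4 * Cin) * KV) :=
          mul_le_mul h1 (h2.trans h3) (norm_nonneg _) (Real.sqrt_nonneg _)
      _ = B := by rw [hB, hsq]; ring

/-- **The derivative of the Mikado factor `V(R̃_{q,i}, n_{q+1}Φ_i)`** (the chain rule (5.34) through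
the phase plus the slow derivative through the matrix argument, for the potential profile `V` in
place of `W`): if `‖D¹V‖ ≤ C_V` on `B̄(0, ρ) × ℝ³` with `R̃_{q,i}(t,x) ∈ B̄(0,ρ)` and
`‖∂ⱼR̃_{q,i}(t,x)‖ ≤ R₁`, then `‖∂ⱼ[V(R̃_{q,i}, n_{q+1}Φ_i)](t,x)‖ ≤ C_V (R₁ + 3 n_{q+1} e^{4C_in})`.
[cite: BuckmasterEtAl2018, Cor. 5.8 (proof, arXiv (5.34))] -/
theorem PerturbationData.norm_partialDeriv_mikadoV_le (H : PerturbationHypotheses P S Nbar Cin C₀)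
    (𝒟 : PerturbationData P S c₀ Cη) (𝔚 : MikadoDatum mikadoRadius) (hCin : 0 ≤ Cin) (ha : 1 ≤ P.a)
    (hb : 1 ≤ P.b) (hβ : 0 ≤ P.β) (hα : 0 ≤ P.α) (hρ : ∀ s ∈ Icc 0 S.T, rhoQ P S s ≠ 0)
    {i : ℕ} {t : ℝ} (ht : t ∈ Icc 0 S.T) {x' : 𝕋³} (hη : 𝒟.cut.η i t x' ≠ 0) {ρ CV R₁ : ℝ}
    (hCV0 : 0 ≤ CV)
    (hCV : ∀ R ∈ Metric.closedBall (0 : 𝕄) ρ, ∀ ξ : ℝ³, ‖iteratedFDeriv ℝ 1 (mikadoLift 𝔚.V) (R, ξ)‖ ≤ CV)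
    {j : Fin 3} {x : 𝕋³} (hRt : tildeR P S 𝒟.cut.η 𝒟.D i t x ∈ Metric.closedBall (0 : 𝕄) ρ)
    (hR1 : ‖Torus.partialDeriv j (tildeR P S 𝒟.cut.η 𝒟.D i t) x‖ ≤ R₁) :
    ‖Torus.partialDeriv j (fun y => 𝔚.V (tildeR P S 𝒟.cut.η 𝒟.D i t y)
        (P.freqNat (S.q + 1) • phiPoint 𝒟.D i t y)) x‖ ≤
      CV * (R₁ + P.freqNat (S.q + 1) * (3 * Real.exp (4 * Cin))) := by
  have hDt : IsSmooth (𝒟.D i t) := (𝒟.flow i).smooth.isSmooth_slice ht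
  have hRm : IsSmooth (tildeR P S 𝒟.cut.η 𝒟.D i t) :=
    isSmooth_matrix_of_entries fun a b =>
      (isSmoothSpaceTimeOn_tildeR H.pos_T H.profile.smooth H.eulerReynolds.smooth_velocity
        H.eulerReynolds.smooth_stress 𝒟.cut.smooth (fun k => (𝒟.flow k).smooth) hρ i a b).isSmooth_slice ht
  have h := norm_partialDeriv_mikado_comp_le (V := 𝔚.V) 𝔚.smooth_V hRm hDt (P.freqNat (S.q + 1))
    hCV0 (fun ξ => hCV _ hRt ξ) j
  refine h.trans (mul_le_mul_of_nonneg_left (max_le ?_ ?_) hCV0)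
  · exact hR1.trans (le_add_of_nonneg_right (by positivity))
  · refine le_add_of_nonneg_of_le ((norm_nonneg _).trans hR1) ?_
    exact mul_le_mul_of_nonneg_left ((norm_single_add_partialDeriv_le 𝒟.D i t x j).trans
      (mul_le_mul_of_nonneg_left (𝒟.norm_gradPhi_le H hCin ha hb hβ hα ht hη x) (by norm_num)))
      (Nat.cast_nonneg _)

/-- **The derivative bound on `Z` at fixed parameters** (the computation of arXiv (5.35) for the
potential in place of `w_o`, with unspecified constants): under the standing hypotheses with
`N̄ ≥ 1`, `C_in ≥ 0`, `c₀ > 0`, `a ≥ 1`, `4δ_{q+2} ≤ δ_{q+1}λ_q^{-α}`, given bounds `K_V` on `V` and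
`C_V` on `D¹V` over the ball `‖R‖_∞ ≤ 9e^{8C_in}(1 + 8C_in)` (Remark 5.2) and a `C¹` bound `B₁` on
`∇Φ_i` over `Ĩ_i` (Prop. 5.7 (5.23)), every first spatial derivative of `Z` is bounded on
`[0,T] × T³` by
`9 (δ_{q+1}/c₀)^{1/2} [e^{4C_in}(C_V(9e^{4C_in}(2(1+8C_in)B₁ + 8C_in e^{4C_in}ℓ⁻¹) + 3n_{q+1}e^{4C_in})) + B₁K_V + max(C(0,1),0)·e^{4C_in}K_V]`
(by the Leibniz rule for `ρ_{q,i}^{1/2} • ∇Φ_iᵀ V`: Lemmas 5.3–5.4 for `∂ⱼρ_{q,i}^{1/2}`, (5.23) for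
`∂ⱼ∇Φ_iᵀ`, (5.24) for `∂ⱼR̃_{q,i}`, the chain rule (5.34); at most one cut-off is active at each
point and `∂ⱼZ_i = 0` off `supp η_i`). [cite: BuckmasterEtAl2018, Cor. 5.8 (proof, arXiv (5.33)–(5.35))] -/
theorem PerturbationData.norm_partialDeriv_potential_le (H : PerturbationHypotheses P S Nbar Cin C₀)
    (𝒟 : PerturbationData P S c₀ Cη) (𝔚 : MikadoDatum mikadoRadius) (hN : 1 ≤ Nbar) (hc₀ : 0 < c₀)
    (hCin : 0 ≤ Cin) (ha : 1 ≤ P.a) (hb : 1 ≤ P.b) (hβ : 0 ≤ P.β) (hα : 0 ≤ P.α)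
    (h4 : 4 * amp P.β P.a P.b (S.q + 2) ≤ amp P.β P.a P.b (S.q + 1) * freq P.a P.b S.q ^ (-P.α))
    {KV CV B₁ : ℝ} (hKV0 : 0 ≤ KV)
    (hKV : ∀ R ∈ Metric.closedBall (0 : 𝕄) (9 * Real.exp (8 * Cin) * (1 + 8 * Cin)),
      ∀ ξ : 𝕋³, ‖𝔚.V R ξ‖ ≤ KV)
    (hCV0 : 0 ≤ CV)
    (hCV : ∀ R ∈ Metric.closedBall (0 : 𝕄) (9 * Real.exp (8 * Cin) * (1 + 8 * Cin)),
      ∀ ξ : ℝ³, ‖iteratedFDeriv ℝ 1 (mikadoLift 𝔚.V) (R, ξ)‖ ≤ CV)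
    (hB₁ : 0 ≤ B₁)
    (hG1 : ∀ i, HolderSupOnLE (tildeInterval S.T (P.τ S.q) i) (fun s y => gradPhi 𝒟.D i s y) 1 0 B₁)
    {t : ℝ} (ht : t ∈ Icc 0 S.T) (j : Fin 3) (x : 𝕋³) :
    ‖Torus.partialDeriv j (potential P S 𝔚 𝒟.cut.η 𝒟.D t) x‖ ≤
      9 * Real.sqrt (amp P.β P.a P.b (S.q + 1) / c₀) *
        (Real.exp (4 * Cin) *
            (CV * (9 * Real.exp (4 * Cin) * (2 * (1 + 8 * Cin) * B₁ +
              Real.exp (4 * Cin) * (8 * Cin * (mollScale P.β P.α P.a P.b S.q)⁻¹)) +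
              P.freqNat (S.q + 1) * (3 * Real.exp (4 * Cin)))) +
          B₁ * KV + max (Cη 0 1) 0 * Real.exp (4 * Cin) * KV) := by
  -- `ρ_q > 0`, smooth data, smooth factors of the summands at time `t`
  have hρpos : ∀ s ∈ Icc 0 S.T, 0 < rhoQ P S s := fun s hs =>
    lt_of_lt_of_le (div_pos (mul_pos (amp_pos ha _) (Real.rpow_pos_of_pos (freq_pos ha _) _))
      (by norm_num)) (H.le_rhoQ h4 hs)
  have hSD : SmoothData P S 𝒟.cut.η 𝒟.D := H.toSmoothData hc₀ 𝒟 hρpos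
  have hf : ∀ i, IsSmooth (sqrtRhoI P S 𝒟.cut.η i t) := fun i => (hSD.sqrtRhoI i).isSmooth_slice ht
  have hGm : ∀ i, IsSmooth (gradPhi 𝒟.D i t) := fun i =>
    isSmooth_matrix_of_entries fun a b => isSmooth_gradPhi_entry ((𝒟.flow i).smooth.isSmooth_slice ht) a b
  have hA : ∀ i, IsSmooth (fun y => (gradPhi 𝒟.D i t y)ᵀ) := fun i => (hGm i).comp_clm mtranspose
  have hv : ∀ i, IsSmooth (fun y => 𝔚.V (tildeR P S 𝒟.cut.η 𝒟.D i t y)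
      (P.freqNat (S.q + 1) • phiPoint 𝒟.D i t y)) := fun i => (hSD.mikadoV 𝔚 i).isSmooth_slice ht
  have hs : ∀ i, IsSmooth (potentialSummand P S 𝔚 𝒟.cut.η 𝒟.D i t) := fun i =>
    (hf i).smul' (isSmooth_toEuclideanLin (hA i) (hv i))
  -- the bound is nonnegative
  set E : ℝ := Real.exp (4 * Cin) with hE
  have hE0 : 0 ≤ E := (Real.exp_pos _).le
  set B : ℝ := 9 * Real.sqrt (amp P.β P.a P.b (S.q + 1) / c₀) *
        (E * (CV * (9 * E * (2 * (1 + 8 * Cin) * B₁ + E * (8 * Cin * (mollScale P.β P.α P.a P.b S.q)⁻¹)) +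
              P.freqNat (S.q + 1) * (3 * E))) +
          B₁ * KV + max (Cη 0 1) 0 * E * KV) with hB
  have hℓ : 0 < mollScale P.β P.α P.a P.b S.q := mollScale_pos ha _
  have hCη0 : 0 ≤ max (Cη 0 1) 0 := le_max_right _ _
  have hB0 : 0 ≤ B := by positivity
  -- vanishing of `∂ⱼ Z_i` off `supp η_i`
  have hzero : ∀ i, 𝒟.cut.η i t x = 0 →
      Torus.partialDeriv j (potentialSummand P S 𝔚 𝒟.cut.η 𝒟.D i t) x = 0 :=
    fun i hi => partialDeriv_smul_toEuclideanLin_eq_zero (hf i) (hA i) (hv i)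
      (by rw [sqrtRhoI, hi, zero_mul]) (𝒟.partialDeriv_sqrtRhoI_eq_zero ht hi j)
  have e : potential P S 𝔚 𝒟.cut.η 𝒟.D t = fun y =>
      ∑ i ∈ Finset.range (cutoffCount S.T (P.τ S.q)), potentialSummand P S 𝔚 𝒟.cut.η 𝒟.D i t y := rfl
  rw [e, partialDeriv_finset_sum _ (fun i _ => (hs i).isContDiff (by simp)) j x]
  refine 𝒟.cut.norm_sum_le t x hB0 hzero (fun i => ?_) _
  by_cases hi : 𝒟.cut.η i t x = 0
  · rw [hzero i hi, norm_zero]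
    exact hB0
  · -- the bounds on the three factors at `(t, x)`, where `η_i(t,x) ≠ 0`
    have hRt : tildeR P S 𝒟.cut.η 𝒟.D i t x ∈
        Metric.closedBall (0 : 𝕄) (9 * Real.exp (8 * Cin) * (1 + 8 * Cin)) := by
      rw [Metric.mem_closedBall, dist_zero_right]
      exact 𝒟.norm_tildeR_le H hCin ha hb hβ hα h4 ht hi x
    have h1 := 𝒟.abs_sqrtRhoI_le H hc₀ ha ht i x
    have h2 := 𝒟.abs_partialDeriv_sqrtRhoI_le H hc₀ ha (i := i) ht j x
    have h3 : ‖(gradPhi 𝒟.D i t x)ᵀ‖ ≤ E := by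
      rw [Matrix.norm_transpose]
      exact 𝒟.norm_gradPhi_le H hCin ha hb hβ hα ht hi x
    have h4' : ‖Torus.partialDeriv j (fun y => (gradPhi 𝒟.D i t y)ᵀ) x‖ ≤ B₁ := by
      have hd : Torus.partialDeriv j (fun y => (gradPhi 𝒟.D i t y)ᵀ) x = (Torus.partialDeriv j (gradPhi 𝒟.D i t) x)ᵀ :=
        partialDeriv_clm_comp (hGm i) mtranspose j x
      rw [hd, Matrix.norm_transpose]
      exact 𝒟.norm_partialDeriv_gradPhi_le ht hi hB₁ (hG1 i) j x
    have h5 : ‖𝔚.V (tildeR P S 𝒟.cut.η 𝒟.D i t x) (P.freqNat (S.q + 1) • phiPoint 𝒟.D i t x)‖ ≤ KV :=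
      hKV _ hRt _
    have hR1 := 𝒟.norm_partialDeriv_tildeR_le H hN hCin ha hb hβ hα h4 ht hi hB₁ (hG1 i) j x
    have h6 := 𝒟.norm_partialDeriv_mikadoV_le H 𝔚 hCin ha hb hβ hα (fun s hs => (hρpos s hs).ne')
      ht hi hCV0 hCV hRt hR1
    refine (norm_partialDeriv_smul_toEuclideanLin_le (hf i) (hA i) (hv i) (Real.sqrt_nonneg _)
      (mul_nonneg hCη0 (Real.sqrt_nonneg _)) hE0 h1 h2 h3 h4' h5 h6).trans (le_of_eq ?_)
    rw [hB]
    ring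

end Pointwise

/-! ## The bounds on `Z` along the common prefix -/

section PotentialBound

/-- **`‖Z‖₀ ≲ δ_{q+1}^{1/2}` and `‖∇Z‖₀ ≲ δ_{q+1}^{1/2} λ_{q+1}` along the common prefix** (the
analogue for the potential `Z` of Cor. 5.8 (5.29) for `w_o`, with the same proof: the sup half is
`BDSV.PerturbationData.norm_potential_le`; the derivative half
`BDSV.PerturbationData.norm_partialDeriv_potential_le` gives `‖∇Z‖₀ ≲ δ_{q+1}^{1/2}(ℓ⁻¹ + n_{q+1} + 1)`,
and arXiv (6.6) `ℓ⁻¹ ≤ λ_{q+1}` (for `3α < 2(1-β)(b-1)`, `a` large), `n_{q+1} ≤ λ_{q+1}`,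
`1 ≤ λ_{q+1}` conclude). Thresholds: `α < min(α₀(5.23), βb(b-1), (1-β)(b-1)/3)`,
`N̄ = max(N̄(5.23), 1)`, `a` beyond the thresholds of (5.23), of `4δ_{q+2} ≤ δ_{q+1}λ_q^{-α}` and of
(6.6). [cite: BuckmasterEtAl2018, Cor. 5.8 (proof, arXiv (5.33)–(5.35)) and §5.3 (5.28)] -/
theorem potentialBound_stageFact :
    StageFact fun 𝔚 P C S _ _ 𝒟 =>
      SupLE S.T (potential P S 𝔚 𝒟.cut.η 𝒟.D) (C * Real.sqrt (amp P.β P.a P.b (S.q + 1))) ∧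
        DerivSupLE S.T (potential P S 𝔚 𝒟.cut.η 𝒟.D)
          (C * (Real.sqrt (amp P.β P.a P.b (S.q + 1)) * freq P.a P.b (S.q + 1))) := by
  intro 𝔚 c₀ hc₀ Cη β hβ hβ3 b hb1 hb2
  -- Prop. 5.7 (5.23), proved in the tree
  obtain ⟨αG, hαG, hG⟩ := gradPhiBound_holds c₀ hc₀ Cη β hβ hβ3 b hb1 hb2
  have hb0 : (0 : ℝ) < b := by linarith
  have hbm : (0 : ℝ) < b - 1 := by linarith
  have h1β : (0 : ℝ) < 1 - β := by linarith
  refine ⟨min αG (min (β * b * (b - 1)) ((1 - β) * (b - 1) / 3)),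
    lt_min hαG (lt_min (mul_pos (mul_pos hβ hb0) hbm) (div_pos (mul_pos h1β hbm) (by norm_num))),
    fun α hα hαlt => ?_⟩
  have hαG' : α < αG := lt_of_lt_of_le hαlt (min_le_left _ _)
  have hαb : α < 2 * β * b * (b - 1) := by
    have := lt_of_lt_of_le hαlt ((min_le_right _ _).trans (min_le_left _ _))
    nlinarith [mul_pos hβ hb0]
  have hα66 : 3 * α < 2 * (1 - β) * (b - 1) := by
    have := lt_of_lt_of_le hαlt ((min_le_right _ _).trans (min_le_right _ _))
    nlinarith [mul_pos h1β hbm]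
  obtain ⟨NG, hG⟩ := hG α hα hαG' 1
  refine ⟨max NG 1, fun Cin C₀ => ?_⟩
  obtain ⟨C₁, aG, haG, hG⟩ := hG Cin C₀
  -- the constants
  set Cp : ℝ := max Cin 0 with hCp
  have hCp0 : 0 ≤ Cp := le_max_right _ _
  obtain ⟨KV, hKV0, hKV⟩ := 𝔚.exists_bound_V
    (isCompact_closedBall (0 : 𝕄) (9 * Real.exp (8 * Cp) * (1 + 8 * Cp)))
  obtain ⟨CV, hCV0, hCV⟩ := exists_forall_norm_iteratedFDeriv_mikadoLift_le 𝔚.contDiff_mikadoLift_V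
    (isCompact_closedBall (0 : 𝕄) (9 * Real.exp (8 * Cp) * (1 + 8 * Cp))) 1
  set C₁p : ℝ := max C₁ 0 with hC₁p
  have hC₁p0 : 0 ≤ C₁p := le_max_right _ _
  have hCη0 : 0 ≤ max (Cη 0 1) 0 := le_max_right _ _
  set E : ℝ := Real.exp (4 * Cp) with hE
  have hE0 : 0 ≤ E := (Real.exp_pos _).le
  -- the coefficients of `ℓ⁻¹`, of `n_{q+1}` and of `1` in the derivative bound, and the two constants
  set A₁ : ℝ := E * (CV * (9 * E * (2 * (1 + 8 * Cp) * C₁p + E * (8 * Cp)))) + C₁p * KV with hA₁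
  set A₂ : ℝ := E * (CV * (3 * E)) with hA₂
  set A₃ : ℝ := max (Cη 0 1) 0 * E * KV with hA₃
  have hA₁0 : 0 ≤ A₁ := by positivity
  have hA₂0 : 0 ≤ A₂ := by positivity
  have hA₃0 : 0 ≤ A₃ := by positivity
  set Ko : ℝ := 9 * Real.exp (4 * Cp) * KV / Real.sqrt c₀ with hKo
  set Kd : ℝ := 9 / Real.sqrt c₀ * (A₁ + A₂ + A₃) with hKd
  obtain ⟨a₄, ha₄, h4⟩ := exists_threshold_four_amp hb1 hαb
  obtain ⟨a₆, ha₆, h66⟩ := exists_threshold_mollScale_inv_mul_freq_inv_le_one hb1.le hα66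
  refine ⟨max Ko Kd, max aG (max a₄ a₆), lt_max_of_lt_left haG, fun a ha S H 𝒟 => ?_⟩
  have haG' : aG ≤ a := (le_max_left _ _).trans ha
  have ha₄' : a₄ ≤ a := ((le_max_left _ _).trans (le_max_right _ _)).trans ha
  have ha₆' : a₆ ≤ a := ((le_max_right _ _).trans (le_max_right _ _)).trans ha
  have ha1 : (1 : ℝ) ≤ a := haG.le.trans haG'
  have h4q := h4 a ha₄' S.q
  -- the standing hypotheses at the two orders used, with `C_in` replaced by `max C_in 0`
  have HG : PerturbationHypotheses ⟨β, α, a, b⟩ S NG Cin C₀ := H.of_le (le_max_left _ _)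
  have H1 : PerturbationHypotheses ⟨β, α, a, b⟩ S 1 Cp C₀ :=
    (H.of_le (le_max_right _ _)).mono_const ha1 (le_max_left _ _)
  -- (5.23) at `N = 1`, with the constant `C₁p ℓ⁻¹`
  have hℓ : 0 < mollScale β α a b S.q := mollScale_pos ha1 _
  have hmono : C₁ * mollScale β α a b S.q ^ (-((1 : ℕ) : ℝ)) ≤ C₁p * (mollScale β α a b S.q)⁻¹ := by
    rw [Nat.cast_one, Real.rpow_neg_one]
    exact mul_le_mul_of_nonneg_right (le_max_left _ _) (inv_nonneg.2 hℓ.le)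
  have hG1 : ∀ i, HolderSupOnLE (tildeInterval S.T (Params.τ ⟨β, α, a, b⟩ S.q) i)
      (fun s y => gradPhi 𝒟.D i s y) 1 0 (C₁p * (mollScale β α a b S.q)⁻¹) :=
    fun i => (hG a haG' S HG 𝒟 i).1.mono hmono
  -- scales
  have hf1 : 0 < freq a b (S.q + 1) := freq_pos ha1 _
  have h1f : 1 ≤ freq a b (S.q + 1) := one_le_freq ha1 _
  have hL : (mollScale β α a b S.q)⁻¹ ≤ freq a b (S.q + 1) := by
    have h := h66 a ha₆' S.q
    calc (mollScale β α a b S.q)⁻¹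
        = (mollScale β α a b S.q)⁻¹ * (freq a b (S.q + 1))⁻¹ * freq a b (S.q + 1) := by
          field_simp
      _ ≤ 1 * freq a b (S.q + 1) := mul_le_mul_of_nonneg_right h hf1.le
      _ = freq a b (S.q + 1) := one_mul _
  have hn : (Params.freqNat ⟨β, α, a, b⟩ (S.q + 1) : ℝ) ≤ freq a b (S.q + 1) :=
    Params.freqNat_le_freq ⟨β, α, a, b⟩ (by show (0 : ℝ) ≤ a; linarith) (S.q + 1)
  have hσ : Real.sqrt (amp β a b (S.q + 1) / c₀) = Real.sqrt (amp β a b (S.q + 1)) / Real.sqrt c₀ :=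
    Real.sqrt_div (amp_pos ha1 _).le c₀
  constructor
  · -- the sup bound
    intro t ht x
    have h := 𝒟.norm_potential_le H1 𝔚 hc₀ hCp0 ha1 hb1.le hβ.le hα.le h4q hKV0 hKV ht x
    exact h.trans (mul_le_mul_of_nonneg_right (le_max_left _ _) (Real.sqrt_nonneg _))
  · -- the derivative bound and (6.6)
    intro j t ht x
    have hpt : ‖Torus.partialDeriv j (potential ⟨β, α, a, b⟩ S 𝔚 𝒟.cut.η 𝒟.D t) x‖ ≤
        9 * Real.sqrt (amp β a b (S.q + 1) / c₀) *
          (Real.exp (4 * Cp) *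
              (CV * (9 * Real.exp (4 * Cp) * (2 * (1 + 8 * Cp) * (C₁p * (mollScale β α a b S.q)⁻¹) +
                Real.exp (4 * Cp) * (8 * Cp * (mollScale β α a b S.q)⁻¹)) +
                (Params.freqNat ⟨β, α, a, b⟩ (S.q + 1) : ℝ) * (3 * Real.exp (4 * Cp)))) +
            C₁p * (mollScale β α a b S.q)⁻¹ * KV +
            max (Cη 0 1) 0 * Real.exp (4 * Cp) * KV) :=
      𝒟.norm_partialDeriv_potential_le H1 𝔚 le_rfl hc₀ hCp0 ha1 hb1.le hβ.le hα.le h4q hKV0 hKV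
        hCV0 hCV (B₁ := C₁p * (mollScale β α a b S.q)⁻¹) (by positivity) hG1 ht j x
    rw [← hE] at hpt
    set L : ℝ := (mollScale β α a b S.q)⁻¹ with hLdef
    set nn : ℝ := (Params.freqNat ⟨β, α, a, b⟩ (S.q + 1) : ℝ) with hnn
    set lam : ℝ := freq a b (S.q + 1) with hlam
    have hL0 : 0 ≤ L := inv_nonneg.2 hℓ.le
    have hnn0 : 0 ≤ nn := Nat.cast_nonneg _
    -- the bracket is `A₁ L + A₂ n + A₃ ≤ (A₁ + A₂ + A₃) λ_{q+1}`
    have hT : E * (CV * (9 * E * (2 * (1 + 8 * Cp) * (C₁p * L) + E * (8 * Cp * L)) +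
        nn * (3 * E))) + C₁p * L * KV + max (Cη 0 1) 0 * E * KV ≤ (A₁ + A₂ + A₃) * lam := by
      have e : E * (CV * (9 * E * (2 * (1 + 8 * Cp) * (C₁p * L) + E * (8 * Cp * L)) +
          nn * (3 * E))) + C₁p * L * KV + max (Cη 0 1) 0 * E * KV =
          A₁ * L + A₂ * nn + A₃ := by
        rw [hA₁, hA₂, hA₃]; ring
      rw [e]
      have i1 : A₁ * L ≤ A₁ * lam := mul_le_mul_of_nonneg_left hL hA₁0
      have i2 : A₂ * nn ≤ A₂ * lam := mul_le_mul_of_nonneg_left hn hA₂0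
      have i3 : A₃ ≤ A₃ * lam := le_mul_of_one_le_right hA₃0 h1f
      linarith
    have hs0 : 0 ≤ Real.sqrt (amp β a b (S.q + 1)) := Real.sqrt_nonneg _
    have hc0 : 0 < Real.sqrt c₀ := Real.sqrt_pos.2 hc₀
    calc ‖Torus.partialDeriv j (potential ⟨β, α, a, b⟩ S 𝔚 𝒟.cut.η 𝒟.D t) x‖
        ≤ 9 * Real.sqrt (amp β a b (S.q + 1) / c₀) *
            (E * (CV * (9 * E * (2 * (1 + 8 * Cp) * (C₁p * L) + E * (8 * Cp * L)) +
              nn * (3 * E))) + C₁p * L * KV + max (Cη 0 1) 0 * E * KV) := hpt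
      _ ≤ 9 * Real.sqrt (amp β a b (S.q + 1) / c₀) * ((A₁ + A₂ + A₃) * lam) :=
          mul_le_mul_of_nonneg_left hT (by positivity)
      _ = Kd * (Real.sqrt (amp β a b (S.q + 1)) * lam) := by
          rw [hσ, hKd]
          field_simp
      _ ≤ max Ko Kd * (Real.sqrt (amp β a b (S.q + 1)) * freq a b (S.q + 1)) :=
          mul_le_mul_of_nonneg_right (le_max_right _ _) (mul_nonneg hs0 hf1.le)

end PotentialBound

end BDSV

end Literature.Analysis.FluidPDE

/-! ## Arithmetic of the assembly -/

namespace Literature.Analysis.FluidPDE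

namespace BDSV

open FunctionSpaces FunctionSpaces.Torus

section Arith

/-- The interpolated Hölder bound at scale `Λ`: `√3·3·(MΛ)·Λ⁻¹^{1-α} + 2M Λ^α = (3√3 + 2) M Λ^α`.
[folklore] -/
theorem interp_scale_eq {M Λ α : ℝ} (hΛ : 0 < Λ) :
    Real.sqrt 3 * (3 * (M * Λ)) * Λ⁻¹ ^ (1 - α) + 2 * M * Λ ^ α = (Real.sqrt 3 * 3 + 2) * M * Λ ^ α := by
  have e1 : Λ⁻¹ ^ (1 - α) = Λ ^ (-1 + α) := by
    rw [Real.inv_rpow hΛ.le, ← Real.rpow_neg hΛ.le]; congr 1; ring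
  have e2 : Λ * Λ ^ (-1 + α) = Λ ^ α := by
    rw [mul_comm, rpow_mul_self_eq hΛ]; congr 1; ring
  rw [e1, show Real.sqrt 3 * (3 * (M * Λ)) * Λ ^ (-1 + α) = Real.sqrt 3 * 3 * M * (Λ * Λ ^ (-1 + α)) by ring,
    e2]
  ring

/-- **The bookkeeping of the Nash error**: with `‖Z‖ ≤ z₀ ≤ C_Z s`, `‖∇v̄‖ ≤ g₀ ≤ C_v s' λ_q`,
`[Z]_α ≤ c_K C_Z s L^α`, `[∇v̄]_α ≤ c_K C_v s' λ_q L^α` (`s = δ_{q+1}^{1/2}`, `s' = δ_q^{1/2}`,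
`L = λ_{q+1} ≥ 1`, `c_K ≥ 1`), the product bound `2(z₀(g₀ + H_g) + H_z g₀)` times `3 C_R · 2π L⁻¹` is at
most `2π C_R · 18 c_K C_Z C_v · s s' λ_q L^{-1+4α}`. [folklore] -/
theorem nash_arith {s s' lq L α cK Cz Cv CR z₀ g₀ Hz Hg : ℝ} (hs : 0 ≤ s) (hs' : 0 ≤ s') (hlq : 0 ≤ lq)
    (hL1 : 1 ≤ L) (hα : 0 ≤ α) (hcK1 : 1 ≤ cK) (hCz : 0 ≤ Cz) (hCv : 0 ≤ Cv) (hCR : 0 ≤ CR)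
    (hg0 : 0 ≤ g₀) (hHg0 : 0 ≤ Hg)
    (hz : z₀ ≤ Cz * s) (hg : g₀ ≤ Cv * s' * lq) (hHz : Hz ≤ cK * Cz * s * L ^ α)
    (hHg : Hg ≤ cK * Cv * s' * lq * L ^ α) :
    2 * Real.pi * L⁻¹ * (CR * (3 * (2 * (z₀ * (g₀ + Hg) + Hz * g₀)))) ≤
      2 * Real.pi * CR * (3 * (2 * (3 * (cK * (Cz * Cv))))) * (s * s' * lq * L ^ (-1 + 4 * α)) := by
  have hL0 : 0 < L := one_pos.trans_le hL1
  have hLα : 1 ≤ L ^ α := Real.one_le_rpow hL1 hα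
  have hcK0 : 0 ≤ cK := zero_le_one.trans hcK1
  -- `g₀ ≤ cK Cv s' lq L^α`
  have hU0 : 0 ≤ Cv * s' * lq := mul_nonneg (mul_nonneg hCv hs') hlq
  have hg' : g₀ ≤ cK * Cv * s' * lq * L ^ α := by
    calc g₀ ≤ Cv * s' * lq := hg
      _ = 1 * (Cv * s' * lq) * 1 := by ring
      _ ≤ cK * (Cv * s' * lq) * L ^ α := mul_le_mul (mul_le_mul_of_nonneg_right hcK1 hU0) hLα zero_le_one
          (mul_nonneg hcK0 hU0)
      _ = cK * Cv * s' * lq * L ^ α := by ring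
  -- the bracket
  have hV0 : 0 ≤ cK * Cv * s' * lq * L ^ α := by positivity
  have hbr : z₀ * (g₀ + Hg) + Hz * g₀ ≤ 3 * (cK * (Cz * Cv)) * (s * s' * lq * L ^ α) := by
    have h1 : z₀ * (g₀ + Hg) ≤ (Cz * s) * (cK * Cv * s' * lq * L ^ α + cK * Cv * s' * lq * L ^ α) :=
      mul_le_mul hz (add_le_add hg' hHg) (add_nonneg hg0 hHg0) (mul_nonneg hCz hs)
    have h2 : Hz * g₀ ≤ (cK * Cz * s * L ^ α) * (Cv * s' * lq) := mul_le_mul hHz hg hg0 (by positivity)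
    calc z₀ * (g₀ + Hg) + Hz * g₀
        ≤ (Cz * s) * (cK * Cv * s' * lq * L ^ α + cK * Cv * s' * lq * L ^ α) +
            (cK * Cz * s * L ^ α) * (Cv * s' * lq) := add_le_add h1 h2
      _ = 3 * (cK * (Cz * Cv)) * (s * s' * lq * L ^ α) := by ring
  -- `L⁻¹ L^α = L^{-1+α} ≤ L^{-1+4α}`
  have e3 : L⁻¹ * L ^ α = L ^ (-1 + α) := by
    rw [← Real.rpow_neg_one, ← Real.rpow_add hL0]
  have e4 : L ^ (-1 + α) ≤ L ^ (-1 + 4 * α) := Real.rpow_le_rpow_of_exponent_le hL1 (by linarith)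
  have hsl : 0 ≤ s * s' * lq := mul_nonneg (mul_nonneg hs hs') hlq
  calc 2 * Real.pi * L⁻¹ * (CR * (3 * (2 * (z₀ * (g₀ + Hg) + Hz * g₀))))
      ≤ 2 * Real.pi * L⁻¹ * (CR * (3 * (2 * (3 * (cK * (Cz * Cv)) * (s * s' * lq * L ^ α))))) := by
        gcongr
    _ = 2 * Real.pi * CR * (3 * (2 * (3 * (cK * (Cz * Cv))))) * (s * s' * lq * (L⁻¹ * L ^ α)) := by ring
    _ ≤ 2 * Real.pi * CR * (3 * (2 * (3 * (cK * (Cz * Cv))))) * (s * s' * lq * L ^ (-1 + 4 * α)) := by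
        rw [e3]
        exact mul_le_mul_of_nonneg_left (mul_le_mul_of_nonneg_left e4 hsl) (by positivity)

end Arith

end BDSV

end Literature.Analysis.FluidPDE

/-! ## Proof of `BDSV.nashErrorEstimate` -/

namespace Literature.Analysis.FluidPDE

namespace BDSV

open FunctionSpaces FunctionSpaces.Torus

/-- The flat three-torus `T³ = (ℝ/ℤ)³`, local notation. -/
local notation "𝕋³" => UnitAddTorus (Fin 3)

/-- Euclidean `ℝ³`, local notation. -/
local notation "ℝ³" => EuclideanSpace ℝ (Fin 3)

section Assembly

/-- Second partial derivatives from a `C^{2,0}` bound. [folklore] -/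
theorem norm_partialDeriv_partialDeriv_le_of_eContDiffHolderNorm_le {g : 𝕋³ → ℝ³} (hg : IsSmooth g)
    {B : ℝ} (hB : 0 ≤ B) (h : Torus.eContDiffHolderNorm 2 0 g ≤ ENNReal.ofReal B) (i c : Fin 3) (x : 𝕋³) :
    ‖Torus.partialDeriv i (Torus.partialDeriv c g) x‖ ≤ B := by
  have h1 : Torus.eContDiffHolderNorm 1 0 (Torus.partialDeriv c g) ≤ ENNReal.ofReal B :=
    (Torus.eContDiffHolderNorm_partialDeriv_le (k := 1) (hg.isContDiff (WithTop.coe_le_coe.mpr le_top)) c 0).trans h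
  exact norm_partialDeriv_le_of_eContDiffHolderNorm_le ((hg.partialDeriv c).isContDiff (by simp)) hB h1 i x

set_option maxHeartbeats 800000 in
-- the assembly threads some forty quantitative hypotheses through one long proof
/-- **The Nash error estimate holds** (BDSV §6.1.1, arXiv (6.5):
"`‖ℛ(w_{q+1}·∇v̄_q)‖_α ≲ δ_{q+1}^{1/2} δ_q^{1/2} λ_q / λ_{q+1}^{1-α}`", transcribed in
`BDSV.nashErrorEstimate` with the exponent `λ_{q+1}^{-(1-4α)}` of Prop. 6.1 (6.1)): along the common
prefix, the `C^{0,α}` norms of `ℛ((w_{q+1}·∇)v̄_q)` on `[0,T]` are at most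
`C δ_{q+1}^{1/2} δ_q^{1/2} λ_q λ_{q+1}^{-(1-4α)}`. Proof by the Calderón–Zygmund route of the module
docstring: `(w_{q+1}·∇)v̄_q = n_{q+1}⁻¹ div(Z × ∇v̄_q)` (`BDSV.nashSource_eq_smul_tensorDivergence`),
`‖ℛ div G‖_α ≤ C_R ‖G‖_α` (Prop. C.1, `BDSV.holderCZBound_holds`,
`BDSV.holder_antidivergence_tensorDivergence_le`), the product rule and interpolation
(`Torus.eContDiffHolderNorm_crossGradTensor_le`, `Torus.eHolderNorm_le_of_norm_le_of_norm_partialDeriv_le`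
at the scales `λ_{q+1}` for `Z` and `ℓ⁻¹` for `∇v̄_q`), the bounds on `Z` (`BDSV.potentialBound_stageFact`)
and (2.19) at `N = 0, 1`, and arXiv (6.4) `ℓλ_{q+1} ≥ 1`. Thresholds: `α < min(α₀(Z), 1/2, βb(b-1),
(b-1)(1-β)/3)`, `N̄ = max(N̄(Z), 1)`, `a` beyond the thresholds of the bounds on `Z`, of
`2δ_{q+2} ≤ δ_{q+1}λ_q^{-α}` (`ρ_q > 0`) and of (6.4); the constant is
`2π C_R · 18 (3√3+2) · max(C_Z,0) · max(C_in,0)`.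
[cite: BuckmasterEtAl2018, §6.1.1 (arXiv (6.5)) with Prop. 6.1 (6.1)] -/
theorem nashErrorEstimate_holds : nashErrorEstimate := by
  intro 𝔚 c₀ hc₀ Cη β hβ hβ' b hb hb'
  obtain ⟨α₁, hα₁, hP⟩ := potentialBound_stageFact 𝔚 c₀ hc₀ Cη β hβ hβ' b hb hb'
  have hαρ : 0 < β * b * (b - 1) := mul_pos (mul_pos hβ (by linarith)) (by linarith)
  have hα64 : 0 < (b - 1) * (1 - β) / 3 := div_pos (mul_pos (by linarith) (by linarith)) three_pos
  refine ⟨min α₁ (min (min (1 / 2) (β * b * (b - 1))) ((b - 1) * (1 - β) / 3)),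
    lt_min hα₁ (lt_min (lt_min one_half_pos hαρ) hα64), ?_⟩
  intro α hα hαlt
  have hα1' : α < α₁ := lt_of_lt_of_le hαlt (min_le_left _ _)
  have hαr : α < min (min (1 / 2) (β * b * (b - 1))) ((b - 1) * (1 - β) / 3) :=
    lt_of_lt_of_le hαlt (min_le_right _ _)
  have hα1 : α < 1 := by
    have := lt_of_lt_of_le hαr ((min_le_left _ _).trans (min_le_left _ _)); linarith
  have hαρ' : α < 2 * β * b * (b - 1) := by
    have := lt_of_lt_of_le hαr ((min_le_left _ _).trans (min_le_right _ _)); nlinarith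
  have hαb : 3 * α / 2 < (b - 1) * (1 - β) := by
    have := lt_of_lt_of_le hαr (min_le_right _ _); nlinarith
  obtain ⟨N₁, hP⟩ := hP α hα hα1'
  -- the Hölder exponent as an `ℝ≥0` and the Calderón–Zygmund constant
  set r : ℝ≥0 := ⟨α, hα.le⟩ with hr
  have hr0 : 0 < r := hα
  have hr1 : r < 1 := hα1
  have hrα : Real.toNNReal α = r := by
    rw [hr]; exact Real.toNNReal_of_nonneg hα.le
  clear_value r
  obtain ⟨CR, hR⟩ := holder_antidivergence_tensorDivergence_le holderCZBound_holds hr0 hr1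
  refine ⟨max N₁ 1, fun Cin C₀ => ?_⟩
  obtain ⟨C₁, a₁, ha₁, hP⟩ := hP Cin C₀
  obtain ⟨aρ, haρ, hρ⟩ := exists_threshold_amp_succ_succ hb hαρ'
  obtain ⟨a₆, ha₆, h64⟩ := exists_threshold_mollScale_freq_succ hb.le hαb 1
  -- the constants
  have hC₁ : C₁ ≤ max C₁ 0 := le_max_left _ _
  have hCin : Cin ≤ max Cin 0 := le_max_left _ _
  set Cz : ℝ := max C₁ 0 with hCz
  set Cv : ℝ := max Cin 0 with hCv
  have hCz0 : 0 ≤ Cz := le_max_right _ _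
  have hCv0 : 0 ≤ Cv := le_max_right _ _
  set cK : ℝ := Real.sqrt 3 * 3 + 2 with hcK
  have hcK1 : 1 ≤ cK := by
    have := Real.sqrt_nonneg 3; rw [hcK]; nlinarith
  have hcK0 : 0 ≤ cK := zero_le_one.trans hcK1
  clear_value Cz Cv
  refine ⟨2 * Real.pi * (CR : ℝ) * (3 * (2 * (3 * (cK * (Cz * Cv))))), max (max a₁ aρ) a₆,
    lt_max_of_lt_left (lt_max_of_lt_left ha₁), ?_⟩
  intro a ha S H 𝒟
  have ha₁' : a₁ ≤ a := le_trans (le_max_left _ _) (le_trans (le_max_left _ _) ha)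
  have haρ' : aρ ≤ a := le_trans (le_max_right _ _) (le_trans (le_max_left _ _) ha)
  have ha₆' : a₆ ≤ a := le_trans (le_max_right _ _) ha
  have ha1 : (1 : ℝ) ≤ a := le_trans ha₁.le ha₁'
  obtain ⟨eP0, eP1⟩ := hP a ha₁' S (H.of_le (le_max_left _ _)) 𝒟
  have H1 : PerturbationHypotheses ⟨β, α, a, b⟩ S 1 Cv C₀ :=
    (H.of_le (le_max_right _ _)).mono_const ha1 hCin
  have hsm : SmoothData ⟨β, α, a, b⟩ S 𝒟.cut.η 𝒟.D := H.smoothData ha1 (hρ a haρ' S.q) hc₀ 𝒟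
  have hℓL : 1 ≤ mollScale β α a b S.q * freq a b (S.q + 1) := h64 a ha₆' S.q
  -- the parameters at this stage
  set s : ℝ := Real.sqrt (amp β a b (S.q + 1)) with hs
  set s' : ℝ := Real.sqrt (amp β a b S.q) with hs'
  set lq : ℝ := freq a b S.q with hlq
  set L : ℝ := freq a b (S.q + 1) with hL
  set li : ℝ := (mollScale β α a b S.q)⁻¹ with hli
  have hs0 : 0 ≤ s := Real.sqrt_nonneg _
  have hs'0 : 0 ≤ s' := Real.sqrt_nonneg _
  have hlq0 : 0 < lq := freq_pos ha1 _
  have hL0 : 0 < L := freq_pos ha1 _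
  have hL1 : 1 ≤ L := one_le_freq ha1 _
  have hℓ0 : 0 < mollScale β α a b S.q := mollScale_pos ha1 _
  have hli0 : 0 < li := inv_pos.2 hℓ0
  have hliL : li ≤ L := by
    rw [hli, inv_le_iff_one_le_mul₀ hℓ0, mul_comm]; exact hℓL
  -- `n_{q+1}` and `n_{q+1}⁻¹ = 2π λ_{q+1}⁻¹`
  set n : ℕ := Params.freqNat ⟨β, α, a, b⟩ (S.q + 1) with hn
  have hfreq : L = 2 * Real.pi * (n : ℝ) := by
    rw [hL, hn]
    exact Params.freq_eq ⟨β, α, a, b⟩ (by show (0 : ℝ) ≤ a; linarith) (S.q + 1)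
  have hn0 : (0 : ℝ) < n := by
    have hf := hL0
    rw [hfreq] at hf
    exact pos_of_mul_pos_right hf (by positivity)
  have hninv : ((n : ℝ))⁻¹ = 2 * Real.pi * L⁻¹ := by
    rw [hfreq]
    field_simp
  have hninv0 : 0 ≤ ((n : ℝ))⁻¹ := inv_nonneg.2 hn0.le
  clear_value s s' lq li
  intro t ht
  -- the fields at time `t`
  set Zt : 𝕋³ → ℝ³ := potential ⟨β, α, a, b⟩ S 𝔚 𝒟.cut.η 𝒟.D t with hZt
  set vt : 𝕋³ → ℝ³ := S.vbar t with hvt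
  have hZs : IsSmooth Zt := (hsm.potential 𝔚).isSmooth_slice ht
  have hvs : IsSmooth vt := H.eulerReynolds.smooth_velocity.isSmooth_slice ht
  -- pointwise bounds on `Z`, `∇Z` (with the constant `Cz`) and on `∇v̄`, `∇²v̄` ((2.19) at
  -- `N = 0, 1`, with the constant `Cv`), as `ℝ≥0` numbers
  set z₀ : ℝ≥0 := ⟨Cz * s, mul_nonneg hCz0 hs0⟩ with hz₀
  set z₁ : ℝ≥0 := ⟨Cz * s * L, by positivity⟩ with hz₁
  set g₀ : ℝ≥0 := ⟨Cv * s' * lq, by positivity⟩ with hg₀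
  set g₁ : ℝ≥0 := ⟨Cv * s' * lq * li, by positivity⟩ with hg₁
  have hz0 : ∀ x, ‖Zt x‖ ≤ (z₀ : ℝ) := fun x =>
    (eP0 t ht x).trans (mul_le_mul_of_nonneg_right hC₁ hs0)
  have hz1 : ∀ i x, ‖Torus.partialDeriv i Zt x‖ ≤ (z₁ : ℝ) := fun i x => by
    refine (eP1 i t ht x).trans ?_
    show C₁ * (s * L) ≤ Cz * s * L
    nlinarith [mul_nonneg hs0 hL0.le]
  have hv1 := H1.velocity 0 (Nat.zero_le _) t ht
  have hv2 := H1.velocity 1 le_rfl t ht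
  simp only [Nat.cast_zero, neg_zero, Real.rpow_zero, mul_one, zero_add] at hv1
  simp only [Nat.cast_one, Real.rpow_neg_one, Nat.reduceAdd] at hv2
  rw [← hvt, ← hs', ← hlq] at hv1
  rw [← hvt, ← hs', ← hlq, ← hli] at hv2
  have hg0 : ∀ c x, ‖Torus.partialDeriv c vt x‖ ≤ (g₀ : ℝ) := fun c x => by
    have h := norm_partialDeriv_le_of_eContDiffHolderNorm_le (hvs.isContDiff (by simp))
      (mul_nonneg hCv0 (mul_nonneg hs'0 hlq0.le)) hv1 c x
    refine h.trans (le_of_eq ?_)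
    show Cv * (s' * lq) = Cv * s' * lq
    ring
  have hg1 : ∀ i c x, ‖Torus.partialDeriv i (Torus.partialDeriv c vt) x‖ ≤ (g₁ : ℝ) := fun i c x => by
    have h := norm_partialDeriv_partialDeriv_le_of_eContDiffHolderNorm_le hvs
      (mul_nonneg hCv0 (mul_nonneg (mul_nonneg hs'0 hlq0.le) hli0.le)) hv2 i c x
    refine h.trans (le_of_eq ?_)
    show Cv * (s' * lq * li) = Cv * s' * lq * li
    ring
  -- interpolation at the scales `Λ = λ_{q+1}` (for `Z`) and `Λ = ℓ⁻¹` (for `∇v̄`)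
  set ΛZ : ℝ≥0 := ⟨L, hL0.le⟩ with hΛZ
  have hΛZ0 : 0 < ΛZ := hL0
  set Λg : ℝ≥0 := ⟨li, hli0.le⟩ with hΛg
  have hΛg0 : 0 < Λg := hli0
  have hHz := eHolderNorm_le_of_norm_le_of_norm_partialDeriv_le (hZs.isContDiff (by simp)) hr1.le hΛZ0
    hz0 hz1
  have hHg : ∀ c, eHolderNorm r (Torus.partialDeriv c vt) ≤ _ := fun c =>
    eHolderNorm_le_of_norm_le_of_norm_partialDeriv_le ((hvs.partialDeriv c).isContDiff (by simp)) hr1.le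
      hΛg0 (hg0 c) (fun i x => hg1 i c x)
  rw [Fintype.card_fin] at hHz hHg
  set Hz : ℝ≥0 := NNReal.sqrt (3 : ℕ) * ((3 : ℕ) * z₁) * ΛZ⁻¹ ^ (1 - r : ℝ) + 2 * z₀ * ΛZ ^ (r : ℝ) with hHzdef
  set Hg : ℝ≥0 := NNReal.sqrt (3 : ℕ) * ((3 : ℕ) * g₁) * Λg⁻¹ ^ (1 - r : ℝ) + 2 * g₀ * Λg ^ (r : ℝ) with hHgdef
  -- the values of the four Hölder data as real numbers
  have hrR : ((r : ℝ≥0) : ℝ) = α := by rw [hr]; rfl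
  have hz₀R : (z₀ : ℝ) = Cz * s := rfl
  have hz₁R : (z₁ : ℝ) = Cz * s * L := rfl
  have hg₀R : (g₀ : ℝ) = Cv * s' * lq := rfl
  have hg₁R : (g₁ : ℝ) = Cv * s' * lq * li := rfl
  have hΛZR : (ΛZ : ℝ) = L := rfl
  have hΛgR : (Λg : ℝ) = li := rfl
  have hHzR : (Hz : ℝ) = (Real.sqrt 3 * 3 + 2) * (Cz * s) * L ^ α := by
    rw [hHzdef, ← interp_scale_eq (M := Cz * s) (α := α) hL0]
    push_cast
    rw [hz₀R, hz₁R, hΛZR, hrR]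
  have hHgR : (Hg : ℝ) = (Real.sqrt 3 * 3 + 2) * (Cv * s' * lq) * li ^ α := by
    rw [hHgdef, ← interp_scale_eq (M := Cv * s' * lq) (α := α) hli0]
    push_cast
    rw [hg₀R, hg₁R, hΛgR, hrR]
  -- the tensor and `ℛ div`
  have hT := eContDiffHolderNorm_crossGradTensor_le hZs hvs r hz0 hg0 hHz hHg
  have hGs : IsSmooth (crossGradTensor Zt vt) := isSmooth_crossGradTensor hZs hvs
  have hRt := hR (crossGradTensor Zt vt) hGs
  have hdivs : IsSmooth (Torus.tensorDivergence (crossGradTensor Zt vt)) := hGs.tensorDivergence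
  have hanti : IsSmooth (Torus.antidivergence (Torus.tensorDivergence (crossGradTensor Zt vt))) :=
    Torus.isSmooth_antidivergence hdivs
  have hfin : Torus.eContDiffHolderNorm 0 r
      (Torus.antidivergence (Torus.tensorDivergence (crossGradTensor Zt vt))) ≤
      ((CR * (3 * (2 * (z₀ * (g₀ + Hg) + Hz * g₀))) : ℝ≥0) : ℝ≥0∞) := by
    refine (hRt.trans (mul_le_mul_of_nonneg_left hT bot_le)).trans (le_of_eq ?_)
    push_cast
    ring
  -- the Nash term
  have hN : nashSource ⟨β, α, a, b⟩ S 𝔚 𝒟.cut.η 𝒟.D t =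
      ((n : ℝ))⁻¹ • Torus.tensorDivergence (crossGradTensor Zt vt) := by
    funext x
    exact nashSource_eq_smul_tensorDivergence 𝔚 hZs hvs x
  -- assemble in `ℝ≥0∞`
  rw [hrα]
  show Torus.eContDiffHolderNorm 0 r
      (Torus.antidivergence (nashSource ⟨β, α, a, b⟩ S 𝔚 𝒟.cut.η 𝒟.D t)) ≤ _
  rw [hN, Torus.antidivergence_const_smul hdivs, Torus.eContDiffHolderNorm_const_smul (hanti.isContDiff (by simp)),
    Real.enorm_eq_ofReal hninv0]
  calc ENNReal.ofReal ((n : ℝ))⁻¹ *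
        Torus.eContDiffHolderNorm 0 r (Torus.antidivergence (Torus.tensorDivergence (crossGradTensor Zt vt)))
      ≤ ENNReal.ofReal ((n : ℝ))⁻¹ * ((CR * (3 * (2 * (z₀ * (g₀ + Hg) + Hz * g₀))) : ℝ≥0) : ℝ≥0∞) :=
        mul_le_mul_of_nonneg_left hfin bot_le
    _ = ENNReal.ofReal (((n : ℝ))⁻¹ * ((CR * (3 * (2 * (z₀ * (g₀ + Hg) + Hz * g₀))) : ℝ≥0))) := by
        rw [← ENNReal.ofReal_coe_nnreal, ← ENNReal.ofReal_mul hninv0]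
    _ ≤ _ := ENNReal.ofReal_le_ofReal ?_
  -- the real inequality
  rw [hninv]
  push_cast
  rw [hz₀R, hg₀R, hHzR, hHgR]
  have hliα : li ^ α ≤ L ^ α := Real.rpow_le_rpow hli0.le hliL hα.le
  refine nash_arith hs0 hs'0 hlq0.le hL1 hα.le hcK1 hCz0 hCv0 (NNReal.coe_nonneg CR)
    (by positivity) (by positivity) le_rfl le_rfl (le_of_eq (by rw [hcK]; ring)) ?_
  calc (Real.sqrt 3 * 3 + 2) * (Cv * s' * lq) * li ^ α
      ≤ (Real.sqrt 3 * 3 + 2) * (Cv * s' * lq) * L ^ α :=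
        mul_le_mul_of_nonneg_left hliα (by positivity)
    _ = cK * Cv * s' * lq * L ^ α := by rw [hcK]; ring

end Assembly

end BDSV

end Literature.Analysis.FluidPDE
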